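import Literature.MathematicalPhysics.QuantumLattice.FermionKrausPerturbation
import HarnessLib

/-!
# The sparse Kraus perturbation of an even infinite-volume fermion state

Topic `Literature/MathematicalPhysics/QuantumLattice`; namespace
`Literature.MathematicalPhysics.QuantumLattice` (the file path). Vocabulary of `InfVolFermionState.lean`
(`InfVolFermionState`, `FermionOp`, `fermionEmbed`, `PolySite.incl/shiftEmb`, `shiftSet`, `IsEven`) and
`FermionKrausPerturbation.lean` (`krausMap`). Everything is a definition with a body or a PROVED theorem;
no named fact.

This is the state-level half of the local-perturbation argument behind the variational
characterisation of ground states (Bratteli–Kishimoto–Robinson 1978, Thm. 1 and Thm. 2; Ruelle 1969):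
a local completely positive unital (Kraus) map `𝓔(B) = Σ_k V_k⋆ B V_k`, `V_k ∈ 𝔄_{Λ₀}`, `Σ V_k⋆V_k = 𝟙`,
is applied to a state `ω` simultaneously at ALL translates `x + Λ₀` of its support along a sparse
sublattice `x ≡ r (mod a)` of residue class `r ∈ (ℤ/aℤ)^d` (spacing `a` larger than the extent of `Λ₀`, so that distinct translates are
disjoint and the local maps commute). For an EVEN state `ω` and HOMOGENEOUS (even or odd) Kraus operators
the result `sparseState P r ω` is again an infinite-volume state: on a finite region `Λ` only the finitely
many translates meeting `Λ` act (`touch`), inside the finite region `hull = Λ ∪ ⋃ (x + Λ₀)`; compatibility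
along `Λ ⊆ Λ'` holds because the extra translates fix even observables of `Λ` (graded locality) and both
sides vanish on odd ones (`ω` even, the maps commute with `Θ`).

* `KrausPattern d` — the data `(Λ₀, V, a)` with `Σ V_k⋆ V_k = 𝟙`, homogeneity, and the spacing condition;
* `KrausPattern.IsSparse`, `touch`, `hull`, `transEmb`, `localMap`, `sparseMap` (the commuting product of the
  local Kraus maps over the translates meeting a region, a `Finset.noncommProd` in `Module.End`);
* `KrausPattern.sparseState P r ω hω : InfVolFermionState d` and `sparseState_expect`.

## References

* [BratteliKishimotoRobinson1978] O. Bratteli, A. Kishimoto, D. W. Robinson, Commun. Math. Phys. 64 (1978)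
  41–48, proof of Thm. 1 (perturbed states `ω ∘ e^{tγ_B} ∈ C_Λ^ω`) and Thm. 2.
* [Ruelle1969GroundState] D. Ruelle, Commun. Math. Phys. 11 (1969) 339–345, Thm. 2 (translation-invariant states and
  the mean energy).
* [BratteliRobinsonII1997] O. Bratteli, D. W. Robinson, OAQSM 2, §5.2.2 (graded locality), §6.2.7.
-/

noncomputable section

namespace Literature.MathematicalPhysics.QuantumLattice

open Matrix Finset HubbardWave0 Literature.Probability.LatticeModels
open scoped ComplexOrder

variable {d : ℕ}

/-! ### §0. Generic facts about commuting products of endomorphisms -/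

section NoncommProd

variable {α : Type*} {M M' : Type*} [AddCommMonoid M] [Module ℂ M] [AddCommMonoid M'] [Module ℂ M']

/-- A commuting product of endomorphisms each fixing `v` fixes `v`. [folklore] -/
private theorem noncommProd_apply_eq_self (s : Finset α) (f : α → Module.End ℂ M) (comm)
    {v : M} (h : ∀ x ∈ s, f x v = v) : s.noncommProd f comm v = v := by
  refine Finset.noncommProd_induction s f comm (fun Φ => Φ v = v) (fun Φ Ψ hΦ hΨ => ?_) rfl h
  rw [Module.End.mul_apply, hΨ, hΦ]

/-- A commuting product of endomorphisms preserving a predicate preserves it. [folklore] -/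
private theorem noncommProd_apply_induction (s : Finset α) (f : α → Module.End ℂ M) (comm)
    (p : M → Prop) (h : ∀ x ∈ s, ∀ X, p X → p (f x X)) (X : M) (hX : p X) :
    p (s.noncommProd f comm X) := by
  have key : ∀ Y, p Y → p (s.noncommProd f comm Y) :=
    Finset.noncommProd_induction s f comm (fun Φ => ∀ Y, p Y → p (Φ Y))
      (fun Φ Ψ hΦ hΨ Y hY => by rw [Module.End.mul_apply]; exact hΦ _ (hΨ _ hY)) (fun Y hY => hY) h
  exact key X hX

/-- **Intertwining a commuting product**: if `L (f x X) = g x (L X)` for all `x ∈ s`, then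
`L (∏_{x∈s} f x X) = ∏_{x∈s} g x (L X)`. [folklore] -/
private theorem apply_noncommProd_apply (L : M → M') (s : Finset α) (f : α → Module.End ℂ M)
    (g : α → Module.End ℂ M') (hf) (hg) (h : ∀ x ∈ s, ∀ X, L (f x X) = g x (L X)) (X : M) :
    L (s.noncommProd f hf X) = s.noncommProd g hg (L X) := by
  induction s using Finset.cons_induction_on generalizing X with
  | empty => rw [Finset.noncommProd_empty, Finset.noncommProd_empty, Module.End.one_apply, Module.End.one_apply]
  | cons a s ha IH =>
    rw [Finset.noncommProd_cons, Finset.noncommProd_cons, Module.End.mul_apply, Module.End.mul_apply,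
      h a (Finset.mem_cons_self a s), IH _ _ (fun x hx => h x (Finset.mem_cons_of_mem hx))]

end NoncommProd

/-! ### §1. Kraus patterns and the sparse sublattice -/

/-- **A Kraus pattern**: a finite region `Λ₀ ⊆ ℤ^d`, a finite Kraus family `V_k ∈ 𝔄_{Λ₀}`
(`Σ_k V_k⋆ V_k = 𝟙`) of HOMOGENEOUS operators (each even or odd), and a spacing `a` exceeding the
extent of `Λ₀` in every coordinate (so that the translates `x + Λ₀`, `x ≡ r (mod a)`, are pairwise
disjoint). The local completely positive perturbation of Bratteli–Kishimoto–Robinson's proof of their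
Thm. 1 (`ω ∘ e^{tγ_B}`), prepared for simultaneous application along a sparse sublattice.
[cite: BratteliKishimotoRobinson1978, Thm. 1 (proof) and Thm. 2] -/
structure KrausPattern (d : ℕ) where
  /-- the support of the perturbation -/
  Λ₀ : Finset (Site d)
  /-- number of Kraus operators -/
  m : ℕ
  /-- the Kraus operators -/
  V : Fin m → FermionOp Λ₀
  /-- the spacing of the sparse sublattice -/
  a : ℕ
  /-- completeness `Σ V_k⋆ V_k = 𝟙` -/
  sum_conjTranspose_mul : ∑ k, (V k)ᴴ * V k = 1
  /-- every Kraus operator is even or odd -/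
  homogeneous : ∀ k, parityAut (V k) = V k ∨ parityAut (V k) = -V k
  /-- the spacing exceeds the extent of `Λ₀` -/
  sub_lt : ∀ x ∈ Λ₀, ∀ y ∈ Λ₀, ∀ i, x i - y i < a

namespace KrausPattern

variable (P : KrausPattern d)

/-- `x` lies on the sparse sublattice `{x : x ≡ r (mod a)}` of residue class `r ∈ (ℤ/aℤ)^d`.
[cite: Ruelle1969GroundState, §2 (lattice translations `τ_a`)] -/
def IsSparse (r : Fin d → ZMod P.a) (x : Site d) : Prop := ∀ i, ((x i : ℤ) : ZMod P.a) = r i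

/-- **Distinct sparse translates of `Λ₀` are disjoint.** [cite: BratteliRobinsonII1997, §6.2.1 (local structure of lattice systems)] -/
theorem disjoint_shiftSet_of_ne {r : Fin d → ZMod P.a} {x x' : Site d} (hx : P.IsSparse r x)
    (hx' : P.IsSparse r x') (hne : x ≠ x') : Disjoint (shiftSet x P.Λ₀) (shiftSet x' P.Λ₀) := by
  rw [Finset.disjoint_left]
  intro z hz hz'
  rw [mem_shiftSet] at hz hz'
  apply hne
  funext i
  -- `x' i - x i` is a multiple of `a` of absolute value `< a`
  have hdvd : (P.a : ℤ) ∣ x' i - x i :=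
    (ZMod.intCast_eq_intCast_iff_dvd_sub (x i) (x' i) P.a).1 ((hx i).trans (hx' i).symm)
  have h1 := P.sub_lt _ hz _ hz' i
  have h2 := P.sub_lt _ hz' _ hz i
  simp only [Pi.sub_apply] at h1 h2
  have hlt : |x' i - x i| < P.a := by
    rw [abs_lt]; constructor <;> linarith
  by_contra hxi
  have hne' : x' i - x i ≠ 0 := sub_ne_zero.2 (Ne.symm hxi)
  have hle := Int.le_of_dvd (abs_pos.2 hne') ((dvd_abs _ _).2 hdvd)
  exact absurd (lt_of_le_of_lt hle hlt) (lt_irrefl _)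

/-- **The sparse translates of `Λ₀` meeting the region `Λ`**: `{x ≡ r (mod a) : (x + Λ₀) ∩ Λ ≠ ∅}`,
a finite set. [cite: BratteliKishimotoRobinson1978, Thm. 2 (proof: only regions meeting Λ contribute)] -/
def touch (r : Fin d → ZMod P.a) (Λ : Finset (Site d)) : Finset (Site d) := by
  classical
  exact ((Λ ×ˢ P.Λ₀).image fun p => p.1 - p.2).filter (P.IsSparse r)

/-- Membership in `touch`: sparse, and some point of `x + Λ₀` lies in `Λ`. [cite: BratteliRobinsonII1997, §6.2.1 (local structure of lattice systems)] -/
theorem mem_touch {r : Fin d → ZMod P.a} {Λ : Finset (Site d)} {x : Site d} :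
    x ∈ P.touch r Λ ↔ P.IsSparse r x ∧ ∃ y ∈ P.Λ₀, y + x ∈ Λ := by
  classical
  unfold touch
  rw [Finset.mem_filter, Finset.mem_image, and_comm]
  refine and_congr_right fun _ => ⟨?_, ?_⟩
  · rintro ⟨p, hp, rfl⟩
    rw [Finset.mem_product] at hp
    exact ⟨p.2, hp.2, by rw [add_sub_cancel]; exact hp.1⟩
  · rintro ⟨y, hy, hyx⟩
    exact ⟨(y + x, y), Finset.mem_product.2 ⟨hyx, hy⟩, by simp⟩

/-- Sparse points off `touch` carry translates disjoint from `Λ`. [cite: BratteliRobinsonII1997, §6.2.1 (local structure of lattice systems)] -/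
theorem disjoint_shiftSet_of_not_mem_touch {r : Fin d → ZMod P.a} {Λ : Finset (Site d)} {x : Site d}
    (hx : P.IsSparse r x) (hxt : x ∉ P.touch r Λ) : Disjoint (shiftSet x P.Λ₀) Λ := by
  rw [Finset.disjoint_left]
  intro z hz hzΛ
  rw [mem_shiftSet] at hz
  exact hxt (P.mem_touch.2 ⟨hx, z - x, hz, by rw [sub_add_cancel]; exact hzΛ⟩)

/-- `touch` is monotone in the region. [cite: BratteliRobinsonII1997, §6.2.1 (local structure of lattice systems)] -/
theorem touch_mono (r : Fin d → ZMod P.a) {Λ Λ' : Finset (Site d)} (h : Λ ⊆ Λ') : P.touch r Λ ⊆ P.touch r Λ' := by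
  intro x hx
  rw [mem_touch] at hx ⊢
  obtain ⟨hs, y, hy, hyx⟩ := hx
  exact ⟨hs, y, hy, h hyx⟩

/-- Members of `touch` are sparse. [cite: BratteliRobinsonII1997, §6.2.1 (local structure of lattice systems)] -/
theorem isSparse_of_mem_touch {r : Fin d → ZMod P.a} {Λ : Finset (Site d)} {x : Site d} (hx : x ∈ P.touch r Λ) :
    P.IsSparse r x :=
  (P.mem_touch.1 hx).1

/-- **The hull** of a region: `Λ` together with all sparse translates of `Λ₀` meeting it — the finite
region inside which the sparse perturbation of an observable of `Λ` is computed.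
[cite: BratteliKishimotoRobinson1978, Thm. 2 (proof: the regions meeting Λ)] -/
def hull (r : Fin d → ZMod P.a) (Λ : Finset (Site d)) : Finset (Site d) :=
  Λ ∪ (P.touch r Λ).biUnion fun x => shiftSet x P.Λ₀

/-- `Λ ⊆ hull Λ`. [cite: BratteliRobinsonII1997, §6.2.1 (local structure of lattice systems)] -/
theorem subset_hull (r : Fin d → ZMod P.a) (Λ : Finset (Site d)) : Λ ⊆ P.hull r Λ := Finset.subset_union_left

/-- Translates meeting `Λ` lie in the hull. [cite: BratteliRobinsonII1997, §6.2.1 (local structure of lattice systems)] -/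
theorem shiftSet_subset_hull {r : Fin d → ZMod P.a} {Λ : Finset (Site d)} {x : Site d} (hx : x ∈ P.touch r Λ) :
    shiftSet x P.Λ₀ ⊆ P.hull r Λ :=
  (Finset.subset_biUnion_of_mem (fun x => shiftSet x P.Λ₀) hx).trans Finset.subset_union_right

/-- The hull is monotone. [cite: BratteliRobinsonII1997, §6.2.1 (local structure of lattice systems)] -/
theorem hull_mono (r : Fin d → ZMod P.a) {Λ Λ' : Finset (Site d)} (h : Λ ⊆ Λ') : P.hull r Λ ⊆ P.hull r Λ' :=
  Finset.union_subset_union h (Finset.biUnion_subset_biUnion_of_subset_left _ (P.touch_mono r h))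

/-- A sparse translate off `touch Λ` is disjoint from the whole hull of `Λ`. [cite: BratteliRobinsonII1997, §6.2.1 (local structure of lattice systems)] -/
theorem disjoint_shiftSet_hull {r : Fin d → ZMod P.a} {Λ : Finset (Site d)} {x : Site d}
    (hx : P.IsSparse r x) (hxt : x ∉ P.touch r Λ) : Disjoint (shiftSet x P.Λ₀) (P.hull r Λ) := by
  unfold hull
  rw [Finset.disjoint_union_right, Finset.disjoint_biUnion_right]
  refine ⟨P.disjoint_shiftSet_of_not_mem_touch hx hxt, fun x' hx' => ?_⟩
  exact P.disjoint_shiftSet_of_ne hx (P.isSparse_of_mem_touch hx') (by rintro rfl; exact hxt hx')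

/-! ### §2. The local maps and their commuting product -/

/-- The site injection placing `Λ₀` at the translate `x + Λ₀ ⊆ Λ'`. [cite: BratteliRobinsonII1997, §6.2.1 (translates of local algebras)] -/
def transEmb (x : Site d) {Λ' : Finset (Site d)} (h : shiftSet x P.Λ₀ ⊆ Λ') : PolySite P.Λ₀ ↪ PolySite Λ' :=
  (PolySite.shiftEmb x P.Λ₀).trans (PolySite.incl h)

/-- The underlying site of a placed point is the translated site. [cite: BratteliRobinsonII1997, §6.2.1 (local structure of lattice systems)] -/
@[simp] theorem ofLex_coe_transEmb (x : Site d) {Λ' : Finset (Site d)} (h : shiftSet x P.Λ₀ ⊆ Λ')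
    (p : PolySite P.Λ₀) : ofLex (P.transEmb x h p).1 = ofLex p.1 + x := rfl

/-- Two site injections into `Λ'` whose underlying sites lie in disjoint sets have disjoint images.
[cite: BratteliRobinsonII1997, §6.2.1 (local structure of lattice systems)] -/
theorem disjoint_map_of_sites {X₁ X₂ : Type*} [Fintype X₁] [Fintype X₂] {Λ' : Finset (Site d)}
    (e₁ : X₁ ↪ PolySite Λ') (e₂ : X₂ ↪ PolySite Λ') {S₁ S₂ : Finset (Site d)}
    (h₁ : ∀ p, ofLex (e₁ p).1 ∈ S₁) (h₂ : ∀ p, ofLex (e₂ p).1 ∈ S₂) (hS : Disjoint S₁ S₂) :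
    Disjoint ((Finset.univ : Finset X₁).map e₁) ((Finset.univ : Finset X₂).map e₂) := by
  rw [Finset.disjoint_left]
  intro q hq₁ hq₂
  rw [Finset.mem_map] at hq₁ hq₂
  obtain ⟨p₁, -, rfl⟩ := hq₁
  obtain ⟨p₂, -, hp₂⟩ := hq₂
  have h := h₂ p₂
  rw [hp₂] at h
  exact Finset.disjoint_left.1 hS (h₁ p₁) h

/-- Placements at disjoint translates have disjoint images. [cite: BratteliRobinsonII1997, §6.2.1 (local structure of lattice systems)] -/
theorem disjoint_map_transEmb {x x' : Site d} {Λ' : Finset (Site d)} (h : shiftSet x P.Λ₀ ⊆ Λ')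
    (h' : shiftSet x' P.Λ₀ ⊆ Λ') (hd : Disjoint (shiftSet x P.Λ₀) (shiftSet x' P.Λ₀)) :
    Disjoint ((Finset.univ : Finset (PolySite P.Λ₀)).map (P.transEmb x h))
      ((Finset.univ : Finset (PolySite P.Λ₀)).map (P.transEmb x' h')) :=
  disjoint_map_of_sites _ _ (fun p => PolySite.add_mem_shiftSet x (PolySite.ofLex_mem p))
    (fun p => PolySite.add_mem_shiftSet x' (PolySite.ofLex_mem p)) hd

/-- A placement and an included region with disjoint underlying sets have disjoint images. [cite: BratteliRobinsonII1997, §6.2.1 (local structure of lattice systems)] -/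
theorem disjoint_map_transEmb_incl {x : Site d} {Λ Λ' : Finset (Site d)} (h : shiftSet x P.Λ₀ ⊆ Λ')
    (hΛ : Λ ⊆ Λ') (hd : Disjoint (shiftSet x P.Λ₀) Λ) :
    Disjoint ((Finset.univ : Finset (PolySite P.Λ₀)).map (P.transEmb x h))
      ((Finset.univ : Finset (PolySite Λ)).map (PolySite.incl hΛ)) :=
  disjoint_map_of_sites _ _ (fun p => PolySite.add_mem_shiftSet x (PolySite.ofLex_mem p))
    (fun p => PolySite.ofLex_mem p) hd

/-- **The local Kraus map at the translate `x + Λ₀` inside the region `Λ'`** (the identity if the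
translate does not fit inside `Λ'`). [cite: BratteliKishimotoRobinson1978, Thm. 1 (proof, `e^{tγ_B}`)] -/
def localMap (Λ' : Finset (Site d)) (x : Site d) : Module.End ℂ (FermionOp Λ') := by
  classical
  exact if h : shiftSet x P.Λ₀ ⊆ Λ' then krausMap (P.transEmb x h) P.V else 1

/-- `localMap` when the translate fits. [cite: BratteliKishimotoRobinson1978, Thm. 1 (proof: the local perturbation `e^{tγ_B}`)] -/
theorem localMap_of_subset {Λ' : Finset (Site d)} {x : Site d} (h : shiftSet x P.Λ₀ ⊆ Λ') :
    P.localMap Λ' x = krausMap (P.transEmb x h) P.V := by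
  classical
  unfold localMap
  exact dif_pos h

/-- `localMap` when the translate does not fit. [cite: BratteliKishimotoRobinson1978, Thm. 1 (proof: the local perturbation `e^{tγ_B}`)] -/
theorem localMap_of_not_subset {Λ' : Finset (Site d)} {x : Site d} (h : ¬ shiftSet x P.Λ₀ ⊆ Λ') :
    P.localMap Λ' x = 1 := by
  classical
  unfold localMap
  exact dif_neg h

/-- **Local maps at distinct sparse translates commute.** [cite: BratteliRobinsonII1997, §5.2.2 (graded locality)] -/
theorem commute_localMap {r : Fin d → ZMod P.a} {x x' : Site d} (hx : P.IsSparse r x) (hx' : P.IsSparse r x')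
    (Λ' : Finset (Site d)) : Commute (P.localMap Λ' x) (P.localMap Λ' x') := by
  by_cases hxx : x = x'
  · rw [hxx]
  by_cases h : shiftSet x P.Λ₀ ⊆ Λ'
  · by_cases h' : shiftSet x' P.Λ₀ ⊆ Λ'
    · rw [P.localMap_of_subset h, P.localMap_of_subset h']
      exact krausMap_comm_of_disjoint _ _ (P.disjoint_map_transEmb h h' (P.disjoint_shiftSet_of_ne hx hx' hxx))
        P.homogeneous P.homogeneous
    · rw [P.localMap_of_not_subset h']
      exact Commute.one_right _
  · rw [P.localMap_of_not_subset h]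
    exact Commute.one_left _

/-- Pairwise commutation over a set of sparse points. [cite: BratteliRobinsonII1997, §5.2.2 (graded locality)] -/
theorem pairwise_commute_localMap {r : Fin d → ZMod P.a} {s : Finset (Site d)} (hs : ∀ x ∈ s, P.IsSparse r x)
    (Λ' : Finset (Site d)) :
    (s : Set (Site d)).Pairwise (fun x x' => Commute (P.localMap Λ' x) (P.localMap Λ' x')) :=
  fun x hx x' hx' _ => P.commute_localMap (hs x hx) (hs x' hx') Λ'

/-- **The sparse perturbation map of the region `Λ`**: the commuting product, over the sparse translates
meeting `Λ`, of the local Kraus maps, acting on the local algebra of the hull.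
[cite: BratteliKishimotoRobinson1978, Thm. 2 (proof) and Thm. 1 (proof)] -/
def sparseMap (r : Fin d → ZMod P.a) (Λ : Finset (Site d)) : Module.End ℂ (FermionOp (P.hull r Λ)) :=
  (P.touch r Λ).noncommProd (P.localMap (P.hull r Λ))
    (P.pairwise_commute_localMap (fun _ hx => P.isSparse_of_mem_touch hx) _)

/-- A local map fixes `𝟙`. [cite: BratteliKishimotoRobinson1978, Thm. 1 (proof: the local perturbation `e^{tγ_B}`)] -/
theorem localMap_one (Λ' : Finset (Site d)) (x : Site d) : P.localMap Λ' x 1 = 1 := by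
  by_cases h : shiftSet x P.Λ₀ ⊆ Λ'
  · rw [P.localMap_of_subset h]
    exact krausMap_one _ P.sum_conjTranspose_mul
  · rw [P.localMap_of_not_subset h, Module.End.one_apply]

open scoped MatrixOrder in
/-- A local map preserves positivity. [cite: BratteliKishimotoRobinson1978, Thm. 1 (proof: the local perturbation `e^{tγ_B}`)] -/
theorem localMap_nonneg (Λ' : Finset (Site d)) (x : Site d) {B : FermionOp Λ'} (hB : 0 ≤ B) :
    0 ≤ P.localMap Λ' x B := by
  by_cases h : shiftSet x P.Λ₀ ⊆ Λ'
  · rw [P.localMap_of_subset h]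
    exact krausMap_nonneg _ _ hB
  · rwa [P.localMap_of_not_subset h, Module.End.one_apply]

/-- A local map commutes with the even–odd automorphism. [cite: BratteliRobinsonII1997, §5.2.2 (graded locality)] -/
theorem parityAut_localMap (Λ' : Finset (Site d)) (x : Site d) (B : FermionOp Λ') :
    parityAut (P.localMap Λ' x B) = P.localMap Λ' x (parityAut B) := by
  by_cases h : shiftSet x P.Λ₀ ⊆ Λ'
  · rw [P.localMap_of_subset h]
    exact parityAut_krausMap _ P.homogeneous B
  · rw [P.localMap_of_not_subset h, Module.End.one_apply, Module.End.one_apply]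

/-- **Covariance of the local maps under inclusions of regions**: for `Λ' ⊆ Λ''` and a translate
fitting inside `Λ'`, `Γ(Λ' ⊆ Λ'') ∘ 𝓔_x^{Λ'} = 𝓔_x^{Λ''} ∘ Γ(Λ' ⊆ Λ'')`. [cite: BratteliKishimotoRobinson1978, Thm. 1 (proof: the local perturbation `e^{tγ_B}`)] -/
theorem fermionEmbed_localMap {Λ' Λ'' : Finset (Site d)} (hΛ : Λ' ⊆ Λ'') {x : Site d}
    (h : shiftSet x P.Λ₀ ⊆ Λ') (B : FermionOp Λ') :
    fermionEmbed (PolySite.incl hΛ) (P.localMap Λ' x B) = P.localMap Λ'' x (fermionEmbed (PolySite.incl hΛ) B) := by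
  rw [P.localMap_of_subset h, P.localMap_of_subset (h.trans hΛ), fermionEmbed_krausMap]
  rfl

/-- A local map at a translate disjoint from `Λ ⊆ Λ'` fixes the embedded EVEN observables of `Λ`.
[cite: BratteliRobinsonII1997, §5.2.2 (even elements of disjoint regions commute)] -/
theorem localMap_fermionEmbed_of_disjoint_of_even {Λ Λ' : Finset (Site d)} (hΛ : Λ ⊆ Λ') {x : Site d}
    (hd : Disjoint (shiftSet x P.Λ₀) Λ) {B : FermionOp Λ} (hB : parityAut B = B) :
    P.localMap Λ' x (fermionEmbed (PolySite.incl hΛ) B) = fermionEmbed (PolySite.incl hΛ) B := by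
  by_cases h : shiftSet x P.Λ₀ ⊆ Λ'
  · rw [P.localMap_of_subset h]
    exact krausMap_fermionEmbed_of_disjoint_of_even _ _ (P.disjoint_map_transEmb_incl h hΛ hd)
      P.sum_conjTranspose_mul hB
  · rw [P.localMap_of_not_subset h, Module.End.one_apply]

/-- The sparse map fixes `𝟙`. [cite: BratteliKishimotoRobinson1978, Thm. 1 (proof: the local perturbation `e^{tγ_B}`)] -/
theorem sparseMap_one (r : Fin d → ZMod P.a) (Λ : Finset (Site d)) : P.sparseMap r Λ 1 = 1 := by
  unfold sparseMap
  exact noncommProd_apply_eq_self _ _ _ fun x _ => P.localMap_one _ x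

open scoped MatrixOrder in
/-- The sparse map preserves positivity. [cite: BratteliKishimotoRobinson1978, Thm. 1 (proof: the local perturbation `e^{tγ_B}`)] -/
theorem sparseMap_nonneg (r : Fin d → ZMod P.a) (Λ : Finset (Site d)) {B : FermionOp (P.hull r Λ)} (hB : 0 ≤ B) :
    0 ≤ P.sparseMap r Λ B := by
  unfold sparseMap
  exact noncommProd_apply_induction _ _ _ (fun X => 0 ≤ X) (fun x _ X hX => P.localMap_nonneg _ x hX) B hB

/-- The sparse map commutes with the even–odd automorphism. [cite: BratteliRobinsonII1997, §5.2.2 (graded locality)] -/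
theorem parityAut_sparseMap (r : Fin d → ZMod P.a) (Λ : Finset (Site d)) (B : FermionOp (P.hull r Λ)) :
    parityAut (P.sparseMap r Λ B) = P.sparseMap r Λ (parityAut B) := by
  unfold sparseMap
  exact apply_noncommProd_apply (fun X => parityAut X) _ _ _ _ _ (fun x _ X => P.parityAut_localMap _ x X) B

/-! ### §3. The perturbed state -/

/-- The local expectation functionals of the sparse perturbation of `ω`:
`B ↦ ω_{hull Λ}(∏_{x ∈ touch Λ} 𝓔_x (Γ B))`. [cite: BratteliKishimotoRobinson1978, Thm. 1 (proof: `ω ∘ e^{tγ_B}`)] -/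
def sparseExpect (r : Fin d → ZMod P.a) (ω : InfVolFermionState d) (Λ : Finset (Site d)) : FermionOp Λ →ₗ[ℂ] ℂ :=
  ω.expect (P.hull r Λ) ∘ₗ (P.sparseMap r Λ) ∘ₗ (fermionEmbed (PolySite.incl (P.subset_hull r Λ))).toLinearMap

/-- `sparseExpect` unfolded. [cite: BratteliKishimotoRobinson1978, Thm. 1 (proof: the local perturbation `e^{tγ_B}`)] -/
theorem sparseExpect_apply (r : Fin d → ZMod P.a) (ω : InfVolFermionState d) (Λ : Finset (Site d)) (B : FermionOp Λ) :
    P.sparseExpect r ω Λ B =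
      ω.expect (P.hull r Λ) (P.sparseMap r Λ (fermionEmbed (PolySite.incl (P.subset_hull r Λ)) B)) := rfl

/-- **The key covariance**: for `Λ ⊆ Λ'`, pushing the sparse map of `Λ` into the hull of `Λ'` gives the
partial product, over `touch Λ`, of the local maps of the bigger hull. [cite: BratteliKishimotoRobinson1978, Thm. 1 (proof: the local perturbation `e^{tγ_B}`)] -/
theorem fermionEmbed_sparseMap {r : Fin d → ZMod P.a} {Λ Λ' : Finset (Site d)} (h : Λ ⊆ Λ') (B : FermionOp (P.hull r Λ)) :
    fermionEmbed (PolySite.incl (P.hull_mono r h)) (P.sparseMap r Λ B) =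
      (P.touch r Λ).noncommProd (P.localMap (P.hull r Λ'))
        (P.pairwise_commute_localMap (fun _ hx => P.isSparse_of_mem_touch hx) _)
        (fermionEmbed (PolySite.incl (P.hull_mono r h)) B) := by
  unfold sparseMap
  exact apply_noncommProd_apply (fun X => fermionEmbed (PolySite.incl (P.hull_mono r h)) X) _ _ _ _ _
    (fun x hx X => P.fermionEmbed_localMap (P.hull_mono r h) (P.shiftSet_subset_hull hx) X) B

/-- The extra translates of a bigger region fix the (embedded, even) image of the hull of the smaller one.
[cite: BratteliRobinsonII1997, §5.2.2 (even elements of disjoint regions commute)] -/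
theorem noncommProd_sdiff_apply_eq_self {r : Fin d → ZMod P.a} {Λ Λ' : Finset (Site d)} (h : Λ ⊆ Λ')
    {Y : FermionOp (P.hull r Λ)} (hY : parityAut Y = Y) (comm) :
    (P.touch r Λ' \ P.touch r Λ).noncommProd (P.localMap (P.hull r Λ')) comm
        (fermionEmbed (PolySite.incl (P.hull_mono r h)) Y) =
      fermionEmbed (PolySite.incl (P.hull_mono r h)) Y := by
  refine noncommProd_apply_eq_self _ _ _ fun x hx => ?_
  rw [Finset.mem_sdiff] at hx
  exact P.localMap_fermionEmbed_of_disjoint_of_even (P.hull_mono r h)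
    (P.disjoint_shiftSet_hull (P.isSparse_of_mem_touch hx.1) hx.2) hY

/-- **The sparse Kraus perturbation of an even state is an infinite-volume state.** For a Kraus pattern
`P`, a residue class `r ∈ (ℤ/aℤ)^d` and an EVEN state `ω`: `(sparseState P r ω)_Λ (B) = ω_{hull Λ}(∏_{x ∈ touch Λ} 𝓔_x (Γ B))`.
Normalisation and positivity hold factor by factor; compatibility along `Λ ⊆ Λ'` because the extra
factors fix even observables of `Λ` and both sides vanish on odd ones. This is the state
`ω ∘ ∏_x e^{γ_{B_x}}`-type perturbation of Bratteli–Kishimoto–Robinson (proof of Thm. 1), taken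
simultaneously along the sparse sublattice `x ≡ r (mod a)` as needed for translation-invariant comparison
states (their Thm. 2 / Ruelle 1969 Thm. 2). [cite: BratteliKishimotoRobinson1978, Thm. 1 (proof) and Thm. 2] -/
def sparseState (r : Fin d → ZMod P.a) (ω : InfVolFermionState d) (hω : ω.IsEven) : InfVolFermionState d where
  expect Λ := P.sparseExpect r ω Λ
  expect_one Λ := by
    rw [sparseExpect_apply, map_one, P.sparseMap_one, ω.expect_one]
  expect_nonneg Λ A := by
    open scoped MatrixOrder in
    rw [sparseExpect_apply, fermionEmbed_conjTranspose_mul_self]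
    exact ω.expect_nonneg_of_nonneg _ (P.sparseMap_nonneg r Λ (star_mul_self_nonneg _))
  compatible Λ Λ' h A := by
    rw [sparseExpect_apply, sparseExpect_apply]
    -- split `A` into its even and odd parts
    have hsplit := JordanWigner.self_eq_evenPart_add_oddPart A
    set Ae : FermionOp Λ := (1 / 2 : ℂ) • (A + parityAut A)
    set Ao : FermionOp Λ := (1 / 2 : ℂ) • (A - parityAut A)
    have hAe : parityAut Ae = Ae := JordanWigner.parityAut_evenPart A
    have hAo : parityAut Ao = -Ao := JordanWigner.parityAut_oddPart A
    -- odd part: both sides vanish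
    have hodd : ∀ (Λ₁ : Finset (Site d)) (h₁ : Λ ⊆ Λ₁),
        ω.expect (P.hull r Λ₁) (P.sparseMap r Λ₁
          (fermionEmbed (PolySite.incl (P.subset_hull r Λ₁)) (fermionEmbed (PolySite.incl h₁) Ao))) = 0 := by
      intro Λ₁ h₁
      refine hω.expect_eq_zero_of_odd ?_
      rw [P.parityAut_sparseMap, ← fermionEmbed_parityAut, ← fermionEmbed_parityAut, hAo, map_neg, map_neg,
        map_neg]
    -- even part
    have heven : ω.expect (P.hull r Λ') (P.sparseMap r Λ'
          (fermionEmbed (PolySite.incl (P.subset_hull r Λ')) (fermionEmbed (PolySite.incl h) Ae))) =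
        ω.expect (P.hull r Λ) (P.sparseMap r Λ (fermionEmbed (PolySite.incl (P.subset_hull r Λ)) Ae)) := by
      classical
      -- the image `Y` of the even part under the small sparse map, pushed into the big hull
      set Y : FermionOp (P.hull r Λ) := P.sparseMap r Λ (fermionEmbed (PolySite.incl (P.subset_hull r Λ)) Ae)
      have hY : parityAut Y = Y := by
        rw [P.parityAut_sparseMap, ← fermionEmbed_parityAut, hAe]
      rw [← ω.compatible (P.hull_mono r h) Y]
      congr 1
      -- split the big product along `touch Λ ⊆ touch Λ'`
      have hT : P.touch r Λ' = (P.touch r Λ' \ P.touch r Λ) ∪ P.touch r Λ :=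
        (Finset.sdiff_union_of_subset (P.touch_mono r h)).symm
      unfold sparseMap
      rw [Finset.noncommProd_congr hT (fun _ _ => rfl), Finset.noncommProd_union_of_disjoint Finset.sdiff_disjoint,
        Module.End.mul_apply, fermionEmbed_fermionEmbed, PolySite.incl_trans]
      -- the inner product is the pushed-forward small sparse map
      have hinner : (P.touch r Λ).noncommProd (P.localMap (P.hull r Λ'))
            ((P.pairwise_commute_localMap (fun _ hx => P.isSparse_of_mem_touch hx) _))
            (fermionEmbed (PolySite.incl (h.trans (P.subset_hull r Λ'))) Ae) =
          fermionEmbed (PolySite.incl (P.hull_mono r h)) Y := by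
        rw [P.fermionEmbed_sparseMap h, fermionEmbed_fermionEmbed, PolySite.incl_trans]
      rw [hinner, P.noncommProd_sdiff_apply_eq_self h hY]
    conv_lhs => rw [hsplit]
    conv_rhs => rw [hsplit]
    rw [map_add, map_add, map_add, map_add, map_add, map_add, map_add, heven, hodd Λ' h]
    have h0 := hodd Λ (subset_refl Λ)
    rw [fermionEmbed_fermionEmbed, PolySite.incl_trans] at h0
    rw [h0]

/-- The local expectations of the sparse perturbation (definitional unfolding).
[cite: BratteliKishimotoRobinson1978, Thm. 1 (proof)] -/
theorem sparseState_expect (r : Fin d → ZMod P.a) (ω : InfVolFermionState d) (hω : ω.IsEven)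
    (Λ : Finset (Site d)) (B : FermionOp Λ) :
    (P.sparseState r ω hω).expect Λ B =
      ω.expect (P.hull r Λ) (P.sparseMap r Λ (fermionEmbed (PolySite.incl (P.subset_hull r Λ)) B)) := rfl

end KrausPattern

end Literature.MathematicalPhysics.QuantumLattice

end
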